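/-
Origin: expansion seat `planner-pub-hodgecm-prl1-g4-0`, handover (R) 2026-08-18T07:30:13Z doc-only (`HOME/pub-hodgecm-prl1-g4/replace/HodgeCM/Automorphic/ThetaFacts.lean`, md5 e9b3c9fa, 269 lines);
landed by the gen-7 packager in gate run 26 REPLACES the earlier landed copy of `HodgeCM/Automorphic/ThetaFacts.lean` (run-18 rename map ×4).
-/
/-
Origin: HOME/pub-hodgecm-prl1/lean/Prl1/ThetaFacts.lean — session planner-pub-hodgecm-prl1-0 (unit pub-hodgecm-prl1,
expansion prover a-1).  Intended final place: `HodgeCM/Automorphic/ThetaFacts.lean` (imports `…ThetaModel`).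
Nothing is asserted: every input is a `def … : Prop` / a field of the `Prop`-valued record `ThetaModel.Inputs`,
consumed as an explicit hypothesis by `HodgeCM.Proofs.RealisationConstruction`.
Origin: expansion seat `planner-pub-hodgecm-prl1-0` (unit pub-hodgecm-prl1), handover v1 2026-08-18T03:12:21Z (`HOME/pub-hodgecm-prl1/lean/Prl1/ThetaFacts.lean`, md5 5c70d268);
landed by the gen-5 packager as `HodgeCM/Automorphic/ThetaFacts.lean` (module renamed `Prl1.ThetaFacts` → `HodgeCM.Automorphic.ThetaFacts`, `import Prl1.*` lines renamed accordingly; body otherwise verbatim).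
Run 18 (packager, 2026-08-18T03:3xZ; REFEREE.md referee 3 R3-1.V1/V1b/V1c, referee 2 G-R2-3/G-R2-4/V-R2-1/V-R2-2 — boundary rule:
an internally-minted statement is a prover-owned OPEN INPUT, never a `Fact_`): RENAMED `Open_thetaSub/thetaWedge/thetaGen12/thetaReal34/
chars/occ` → `Open_…`, `Design_kappaConj/frameSignConj` → `Design_…`, `structure ThetaModel.Inputs` → `ThetaModel.Inputs` (field names kept);
labels PRINT/DESIGN/OPEN INPUT below; every statement byte-identical to run 16/17.
Doc-only v2 (2026-08-18, expansion seat planner-pub-hodgecm-prl1-g4-0, unit pub-hodgecm-prl1-g4; source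
`HOME/pub-hodgecm-prl1-g4/replace/HodgeCM/Automorphic/ThetaFacts.lean`): two LOCATOR corrections in the docstrings of
`Fact_embCover` (Rogawski §§12–13 ↦ §15.1–15.3) and `Open_thetaSub` (attribute to PerL only what PerL ll. 291–293 cite), per
cf-rogawski-g3 GAPS cfR3-N3; every declaration byte-identical to run 18–25 (whole-file replacement, no downstream effect).
-/
import Summits.HodgeConjecture.HodgeCM.Automorphic.ThetaModel

set_option autoImplicit false

/-!
# Named inputs of the theta model (PerL v5 §§3–4): 2 PRINT facts, 2 DESIGN constraints, 6 PerL OPEN INPUTS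

Labels used in the docstrings (CONTRIBUTING.md §3 L2/L3, FACTS.md protocol):

* **PRINT** — a published theorem about the intended objects, with citation and page; never mentions algebraicity of
  Hodge classes; candidate row of the model-fact table (prefix `Fact_`: `Fact_embCover`, `Fact_innerEmb`, and
  `Universe.Fact_hodgeRiemann20`).
* **DESIGN** — a definitional constraint on the theta model's OWN posited data (`kappa`, `frameSign`), discharged by
  the instance, not by citation; no published source is claimed (prefix `Design_`; referee 2 V-R2-1/2, referee 3 V1b).
* **OPEN INPUT (PerL-internal, prover-owned)** — a statement of PerL v5 (blob d912a121,
  `HOME/inputs/2001/…pmqp-galois-closure-y1__paper-v5…tex`) proved there from print inputs but not itself in print at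
  this generality ("over PRINT" = its ingredients are published theorems); NEVER a cited fact and never a row of the
  model-fact table (boundary rule, referee 3 R3-1.V1 / referee 2 G-R2-3); the docstring names PerL's lemma, the print
  ingredients, the EXACT OBSTRUCTION to citing it, and the input that would close it; prefix `Open_`.  These six are
  exactly the DAG nodes N12 / N33 / N19w / N19g / N31 / N29 of `HOME/LEMMAS.md` that the node provers discharge.
* **PROVABLE** — elementary, provable in Mathlib v4.32.0 with work that this cell has not done; stated as a
  hypothesis so that nothing is asserted.

Two facts do not mention the theta model at all and are stated first: `Universe.Fact_hodgeRiemann20` (PRINT, a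
geometric model fact in the format of `HodgeCM.Geometry.Facts`) and `HodgeCM.LevelDirected` (PROVABLE — and PROVED downstream:
`HodgeCM.levelDirected` in `HodgeCM.Proofs.LevelDirected`; the `hLD`-free primed forms of every consumer are in `HodgeCM.Assembly.CorCMThetaPrime`; the
named `Prop` is kept because `HodgeCM.Proofs.RealisationConstruction` takes it as the hypothesis `hLD`).
-/

noncomputable section

open scoped TensorProduct InnerProductSpace

namespace HodgeCM

open Literature.AlgebraicGeometry.Motives (CMType HodgeStructure)
open Literature.AlgebraicGeometry.Motives.HodgeStructure (conj)
open Literature.AlgebraicGeometry.ShimuraVarieties (conjRingHomK)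
open NumberField (ComplexEmbedding.conjugate)
open HodgeCM.Prior.Perl34File

/-- **PROVABLE (directedness of levels).** Two torsion-free congruence subgroups of `U(V₃,h)(L₀)` have a common
torsion-free congruence refinement — their intersection: it is torsion free trivially and congruence because a
principal congruence subgroup `Γ(n)` has finite index in `U(h)(𝓞)` (Borel, *Introduction aux groupes
arithmétiques* §7; any text).  **PROVED** in `HodgeCM.Proofs.LevelDirected` (`HodgeCM.levelDirected`, 0 hypotheses)
by a route that avoids the index computation: `Γ(n₁) ⊓ Γ(n₂) = Γ(lcm(n₁,n₂))` (entrywise Bézout in `𝓞_L`,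
`IsCongruentOneMod.of_coprime`) and `Subgroup.relIndex` bookkeeping, so `Γ(n₁ n₂) ≤ Γ₁ ⊓ Γ₂` has finite index.
Kept here as a named `Prop` because `HodgeCM.Proofs.RealisationConstruction` consumes it as the hypothesis `hLD`
(field `ThetaRealisation.level_inf`); the primed theorems of `HodgeCM.Assembly.CorCMThetaPrime` discharge it. -/
def LevelDirected : Prop :=
  ∀ (L : CMField) (ι₁ : L →+* ℂ) (V : HermSpace3 L ι₁) (Γ₁ Γ₂ : Level V),
    ∃ Γ : Level V, Γ.Γ ≤ Γ₁.Γ ∧ Γ.Γ ≤ Γ₂.Γ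

namespace Universe

variable (U : Universe)

/-- **PRINT (Hodge–Riemann bilinear relations in bidegree (2,0) on a surface; model-fact candidate).** On a smooth
projective SURFACE `X` (`dim X = 2`) a nonzero class `η ∈ F²H²(X) = H^{2,0}(X)` has `∫_X η ∪ η̄ ≠ 0` (indeed
`> 0`: every `(2,0)`-class is primitive and the Hodge–Riemann form `(−1)^{k(k−1)/2} i^{p−q} ∫ α ∧ ᾱ`, `k = 2`,
`(p,q) = (2,0)`, is positive definite — Voisin, *Hodge Theory and Complex Algebraic Geometry I*, Thm 6.32 (held edition PDF p. 128
l. 35, VERBATIM-checked by referees 2 and 3) with Thm 6.33 (Hodge index; PDF p. 129 l. 15) / §6.3.2; Griffiths–Harris p. 123; Wells, *Differential Analysis on Complex Manifolds* Thm V.6.2).  Only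
`≠ 0` is recorded (normalisation-free).  Over Universe primitives (`hodge`, `cup`, `tr` via `cup2C`, `trC`), no
algebraicity mentioned.  Consumed to show that the Matsushima embedding does not kill a nonzero holomorphic 2-form
(`HodgeCM.Proofs.RealisationConstruction.emb_ne_zero`). -/
def Fact_hodgeRiemann20 : Prop :=
  ∀ (X : U.Var), U.dim X = 2 → ∀ η : U.CohC X 2, η ∈ (U.hodge X 2).F 2 → η ≠ 0 →
    U.trC X 4 (U.cup2C X 2 η (conj η)) ≠ 0

namespace ThetaModel

variable {U}
variable (T : U.ThetaModel)

/-- **PRINT (level independence of automorphic functions).** The `L²` function on `[G_U]` of a class does not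
change under pull-back to a smaller level: `emb Γ' (π^* η) = emb Γ η` for the covering `π : P_{Γ'} → P_Γ`
(adelic automorphic forms are functions on `G_U(L₀)\G_U(𝔸)`, of which every `Γ\𝔹²` is a finite quotient).
Sources (published, page-located — referee 2 R2-1 (3) / G-R2-4 read them): Borel–Wallach, *Continuous Cohomology,
Discrete Subgroups, and Representations of Reductive Groups* (2nd ed., Math. Surveys Monogr. 67) VII §2 (pp. 139–142)
and Thm 3.2 (pp. 142–143; held e-text chunk p0180 l. 16), the `L²` scalar product `(u,v)` "by integrating it over
`Γ\G`" (VII 3.1, p. 142; chunk p0180 l. 4; on cochains II 2.2(3) p. 33, VII 2.7 p. 141) — the operative source; for the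
cohomology of the quotients `Γ\𝔹²` of `G_U` specifically, Rogawski, *Automorphic Representations of Unitary Groups in Three
Variables* (Ann. of Math. Stud. 123, 1990) §15.1–15.3 (pp. 246–250: `Γ_K`, `H¹(Γ_K, ℂ)` via Matsushima / Borel–Wallach,
Prop 15.2.1, Thm 15.3.1) — locator corrected 2026-08-18 (doc-only v2) per cf-rogawski-g3 GAPS cfR3-N3: §§12–13 of that book,
cited here in v1, are the local/global packet chapters and contain no statement about the form ↦ automorphic-function
embedding.  Cross-reference (NOT a source): PerL §3.1 (eq. (Qaut)) ll. 238–247.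
An INTERFACE fact about the posited datum `emb` (true for the Matsushima–Murakami harmonic-form ↦ automorphic-function
embedding of the intended model).  Consumed as `ThetaRealisation.Λ_cover` (with `Fact_pull_cup`). -/
def Fact_embCover : Prop :=
  ∀ {L : CMField} {ι₁ : L →+* ℂ} {V : HermSpace3 L ι₁} (Γ Γ' : Level V) (h : Γ'.Γ ≤ Γ.Γ)
    (η : U.CohC (U.pms L ι₁ V Γ) 2), T.emb Γ' (U.pullC (T.cover Γ Γ' h) 2 η) = T.emb Γ η

/-- **PRINT (Petersson = cup pairing on holomorphic 2-forms).** At each level there is `c_Γ ≠ 0` with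
`⟪emb η', emb η⟫_{L²([G_U])} = c_Γ · ∫_{P_Γ} η ∪ η̄'` for all `η, η' ∈ F²H²(P_Γ)`.  Sources (published, page-located —
referee 2 G-R2-4; book pages per cf-matsushima-murakami GAPS cfmm-P6, verbatim texts CITED-FACTS.md MM-1/MM-3/MM-4):
Borel–Wallach (2nd ed.) VII Thm 3.2 (pp. 142–143; held e-text chunk p0180 l. 16: `H^{2,0}(Γ\𝔹²)` =
square-integrable `(∧²τ)⁻¹`-equivariant automorphic forms), the `L²` scalar product by integration over `Γ\G`
(VII 3.1, p. 142; chunk p0180 l. 4; II 2.2(3) p. 33, VII 2.7 p. 141), 3.5 Remarks (Matsushima) (p. 144; chunk p0182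
l. 1), 3.6 the complex case (p. 145; chunk p0182 l. 11); Matsushima–Murakami — the `L²` inner product is the
integral of `η ∧ η̄'` against the invariant volume up to the volume normalisation `c_Γ`.  Cross-reference (NOT a
source): PerL §3.1 ll. 238–257 and the last display of the proof of Thm 4.4, ll. 693–699.  An INTERFACE fact about the
posited datum `emb`.  Mathlib's inner product is conjugate-linear in the FIRST slot, whence the order.  Consumed as
`ThetaRealisation.inner_Λ`. -/
def Fact_innerEmb : Prop :=
  ∀ {L : CMField} {ι₁ : L →+* ℂ} {V : HermSpace3 L ι₁} (Γ : Level V), ∃ c : ℂ, c ≠ 0 ∧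
    ∀ η η' : U.CohC (U.pms L ι₁ V Γ) 2,
      η ∈ (U.hodge (U.pms L ι₁ V Γ) 2).F 2 → η' ∈ (U.hodge (U.pms L ι₁ V Γ) 2).F 2 →
      ⟪T.emb Γ η', T.emb Γ η⟫_ℂ = c * U.trC (U.pms L ι₁ V Γ) 4 (U.cup2C (U.pms L ι₁ V Γ) 2 η (conj η'))

/-- **DESIGN — definitional constraint on the model's own datum `kappa`, discharged by the instance, not by citation
(sign recipe commutes with complex conjugation, `κ`).** `κ(τ̄) = \overline{κ(τ)}`:
for PerL's recipe `κ(ι₁ ∘ ρ) = (ρ⁻¹ φ^h)|_K` (eq:Psit, ll. 61–64) this is the centrality of complex conjugation `c`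
in the Galois group of the CM field `L` (`(cρ)⁻¹φ^h = c·ρ⁻¹φ^h`); for a general pair `K →+* L` the model chooses
any conjugation-equivariant recipe (the facts below only constrain good contexts). -/
def Design_kappaConj : Prop :=
  ∀ (K L : CMField) (j : K →+* L) (ι₁ τ : L →+* ℂ),
    T.kappa K L j ι₁ (ComplexEmbedding.conjugate τ) = ComplexEmbedding.conjugate (T.kappa K L j ι₁ τ)

/-- **DESIGN — definitional constraint on the model's own datum `frameSign`, discharged by the instance, not by
citation (frame sign flips under conjugation; our convention).** The frame sign is attached to ONE
of the two embeddings over each real place of `L₀` (cross-reference, NOT a source: [Y1neg] v2 Lemma 3.1, the representatives `ρ_b`; at `ι₁`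
the holomorphy sign `ε_hol`, Lemma 3.2), so it flips at the conjugate embedding — this is what makes the required
sign `reqPos` a function of the PLACE (`HodgeCM.Proofs.RealisationConstruction.reqPos_conjugate`). -/
def Design_frameSignConj : Prop :=
  ∀ (L : CMField) (ι₁ τ : L →+* ℂ), T.frameSign L ι₁ (ComplexEmbedding.conjugate τ) = !(T.frameSign L ι₁ τ)

/-- **OPEN INPUT — PerL-internal, prover-owned, never a cited fact (typing of theta one-forms; PerL Lemma 3.3(a) + Prop 2.2, [Y1neg] v2 Thm 8.1(a) / Prop 6.2).** In
a good context the theta one-forms of type `Ψ_i` are `B_{Ψ_i}`-isotypic `σ`-eigen holomorphic one-forms: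
`Theta c i Γ ⊆ U_{Ψ_i}(Γ)` (`Universe.Uiso`).  PerL: Lemma 3.3(a) (tex ll. 280–298: every constituent `σ'` of the
lift of an allowed pair of type `Ψ_i` has automorphic type `Φ'(σ') = Ψ_i`, by the theta correspondence AS PerL CITES IT
there — ll. 291–293: Kudla; Mœglin–Vignéras–Waldspurger Ch. 5, "as recorded in [Y1neg] (P2) display (4)"; [Y1neg]
Lemmas 3.1/3.2/4.1/4.2 — with the archimedean type bookkeeping (eq:Phiprime) = [Y1neg] Lemma 4.2 / Thm 8.1(a); attribution
corrected 2026-08-18 (doc-only v2) per cf-rogawski-g3 GAPS cfR3-N3: v1's "Gelbart–Rogawski §3, Rogawski §12.3" are NOT cited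
by PerL v5 (0 hits) and [Rog90] §12.3 is the real-place packet table, not a theta correspondence), then Prop 2.2
(`prop:dict`, ll. 168–209: forms of automorphic type `Ψ_t` are exactly the
`B_t`-isotypic `φ₁`-eigen ones, via [Y1neg] Prop 6.2 (eq:Na) and the reflex Lemma 2.1).  OBSTRUCTION to a print
citation: Prop 2.2 is PerL's own dictionary; its proof uses primitivity of `Φ_t` (Lemma 2.1(b),(c): `B_t` simple,
`L^*_{Ψ_t} = K`), which holds for PerL's sextic types and must be re-derived for imprimitive face types of rfwf
(`A_{(K,Φ)} ∼ B^m` with `B` of the primitive quotient type; pull-backs factor through the projection).  CLOSING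
INPUT: [Y1neg] v2 Prop 6.2 + Thm 8.1(a) as stated there for an arbitrary CM field `L` and hermitian line, plus
Shimura–Taniyama II §5 / Shimura 1998 §8 Thm 3 (abelian variety of an induced type). -/
def Open_thetaSub : Prop :=
  ∀ {L : CMField} {ι₁ : L →+* ℂ} (V : HermSpace3 L ι₁) (c : SeesawCtx L), T.GoodCtx ι₁ c →
    ∀ (i : Fin 4) (Γ : Level V), T.Theta V c i Γ ⊆ U.Uiso Γ c.K (c.Ψ i) c.σ

/-- **OPEN INPUT — PerL-internal, prover-owned, never a cited fact (PerL Prop 4.3 `prop:S12`, tex ll. 639–684 — the heart; v1 → v2 repair point).** In a good context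
there are, at SOME torsion-free congruence level, theta one-forms `ω₁` of type `Ψ₀` and `ω₂` of type `Ψ₁` with
`ω₁ ∪ ω₂ ≠ 0` in `H²(P_Γ, ℂ)`.  PerL's proof: SUPPLY (Lemma 4.2(a), ll. 527–638: allowed pairs with `θ_φ(χ') ≠ 0`
exist for each type — Rallis inner product formula (eq:basic) l. 565, [GQT §11.3], [Li92 Thm 2.1], local
non-vanishing [HKS (1.14)–(1.15)], and the forced signatures of Lemma 3.3: `W₁ ⊕ W₂` of signature `(2,0)`/`(0,2)`
at `ι₁`, definite on `D₁₂`, `(1,1)` on the non-empty `Σ₁₂` — non-empty BECAUSE `Ψ₀ ≠ Ψ₁`, whence `injective`);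
then the LINE-FIELD argument (ll. 643–684): the spans `𝒰_i` of the forms `u_f` over all `χ'_i, φ` are
`G_U(L₀)`-stable (Hecke translates, l. 656) and nonzero; if every wedge vanished, evaluation at a point would give
a line field on `𝔹²` invariant under the image of `G_U(L₀)`, dense in `U(2,1)` by real approximation (Sansuc
Cor. 3.5(iii); Platonov–Rapinchuk Thm 7.7), hence a `K_{x₀} ≅ U(2) × U(1)`-invariant line in `T^*_{x₀}𝔹² ≅ ℂ²` —
impossible (`SU(2)` transitive on lines).  FORM OF THE STATEMENT (referee A round 12, G4 / adv2-O2): Prop 4.3's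
proof yields the SPAN form (some `u₁ ∈ 𝒰₁`, `u₂ ∈ 𝒰₂` with `u₁ ∧ u₂ ≠ 0`); the single-datum clause consumed here
follows by bilinearity (a finite sum of wedges `≠ 0` has one nonzero term `u_{f₁} ∧ u_{f₂}`, both data allowed by
Lemma 4.2(b); common level by intersection, `Level.inf`), and `ω₁ ∪ ω₂ ≠ 0` in `H²` ⇔ `u₁ ∧ u₂ ≠ 0` as a form
(`H^{2,0} ↪ H²` on a compact Kähler surface) — this step is MACHINE-CHECKED in the two refinements that derive
this input from finer ones, `HodgeCM.Automorphic.ThetaWedgeSplit` (`exists_cup_ne_zero_of_ballFacts`, via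
`HodgeCM.LineField.lineField_false`) and `HodgeCM.Automorphic.HeckeWedge` (`exists_cup_ne_zero_of_hecke`, from
Venkataramana, Compositio Math. 125 (2001) Thm 8).  OBSTRUCTION to a print citation: the statement is PerL's own (no
published non-vanishing of wedges of theta one-forms on Picard modular surfaces); the group-theoretic core is
print, the identification `u_f ↔` classes in `H¹(P_Γ, ℂ)` at torsion-free level is Matsushima–Murakami.  CLOSING
INPUT: a referee-checked PerL v5 Prop 4.3, or its formalisation over a model of `𝒜(G_U)`. -/
def Open_thetaWedge : Prop :=
  ∀ {L : CMField} {ι₁ : L →+* ℂ} (V : HermSpace3 L ι₁) (c : SeesawCtx L), T.GoodCtx ι₁ c →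
    ∃ Γ : Level V, ∃ ω₁ ∈ T.Theta V c 0 Γ, ∃ ω₂ ∈ T.Theta V c 1 Γ, U.cup2C (U.pms L ι₁ V Γ) 1 ω₁ ω₂ ≠ 0

/-- **OPEN INPUT — PerL-internal, prover-owned, never a cited fact (PerL Lemma 3.5 `lem:S12`, seesaw direction, pair (12); tex ll. 350–396).** In a good context the
`L²` function of the wedge of theta one-forms of types `Ψ₀, Ψ₁` lies in `S₁₂`: it IS (a multiple of) the generator
`ϑ_{T,χ₁χ₂}(Φ₁ ⊗ Φ₂)` by the seesaw identity `θ_{φ₁}(g,χ'₁) θ_{φ₂}(g,χ'₂) = ∫_{[T]} θ_{Φ₁⊗Φ₂}(g,t) χ(t) dt` (Kudla's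
splitting `ω_W|_{G_U × T} = ω_{W₁} ⊠ ω_{W₂}`, [Kudla 1994 §1], Harris–Kudla–Sweet JAMS 9 (1996) §§1–3; PerL
ll. 360–380) and Lemma 3.4 (`lem:Krat`: the wedge of the one-forms is the product of the scalar functions in the
`(∧²τ)⁻¹`-model, ll. 219–237).  OBSTRUCTION: PerL's own assembly of print identities for THIS seesaw
(`U(1) × U(1) ⊂ U(2)` against `U(2,1)`); no single citable theorem.  CLOSING INPUT: PerL v5 Lemma 3.5 refereed, or
the seesaw identity formalised over a model of the Weil representation. -/
def Open_thetaGen12 : Prop :=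
  ∀ {L : CMField} {ι₁ : L →+* ℂ} (V : HermSpace3 L ι₁) (c : SeesawCtx L), T.GoodCtx ι₁ c →
    ∀ (Γ : Level V) (ω₁ ω₂ : U.CohC (U.pms L ι₁ V Γ) 1), ω₁ ∈ T.Theta V c 0 Γ → ω₂ ∈ T.Theta V c 1 Γ →
      T.Λ Γ ω₁ ω₂ ∈ (T.t12 V c).S12

/-- **OPEN INPUT — PerL-internal, prover-owned, never a cited fact (PerL Lemma 3.5 `lem:S12`, generation direction, pair (34), CLOSURE form; tex ll. 350–353 with
ll. 381–396).** In a good context every generator `ϑ_{T',χ}(Φ)` of `S₃₄` (`χ` allowed of type (34), `Φ ∈ 𝒮^κ`) lies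
in the closed span of the wedge-functions of theta one-forms of types `Ψ₂, Ψ₃` over all levels.  PerL: for
Fock-polynomial `Φ = Σ Φ₃^{(k)} ⊗ Φ₄^{(k)}` the seesaw identity writes `ϑ_{T',χ}(Φ)` as a finite sum of products
`θ_{φ₃}(χ'₃) θ_{φ₄}(χ'₄)`, each the function of a wedge `u₃ ∧ u₄` at a deep enough torsion-free level
(Matsushima–Murakami; smooth `K_f`-finite vectors are fixed by some neat compact open); general Schwartz `Φ` by
density of `pr_κ(𝒫)` in `𝒮^κ` and continuity of `Φ ↦ ϑ` (AX5b).  OBSTRUCTION / CLOSING INPUT: as for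
`Open_thetaGen12` (same identity read in the other direction), plus the archimedean Lemma 4.1(b) (ll. 479–526)
identifying the `κ`-part.  This is exactly the field `ThetaRealisation.real34` in its gen-7 form. -/
def Open_thetaReal34 : Prop :=
  ∀ {L : CMField} {ι₁ : L →+* ℂ} (V : HermSpace3 L ι₁) (c : SeesawCtx L), T.GoodCtx ι₁ c →
    ∀ χ : (T.t34 V c).X, (T.t34 V c).allowed χ → ∀ Φ : T.SK V c,
      (T.t34 V c).ϑ χ Φ ∈ (Submodule.span ℂ (T.wedgeSet V c 2 3)).topologicalClosure

/-- **OPEN INPUT over PRINT — PerL-internal, prover-owned, never a cited fact (PerL Lemma 4.2(b) `lem:chars`, tex ll. 527–638; = hypothesis `H_chars` of Prop 3.6 /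
Thm 3.7, ll. 398–400, 441–442).** In a good context every character of `[T]` (resp. `[T']`) of the forced
archimedean type `w` (resp. `w'`) arises from an allowed pair of type (12) (resp. (34)).  Print ingredients: the
Rallis inner product formula for `U(1) → U(2,1)` / `U(3)` theta lifts (PerL (eq:basic) l. 565 from [GQT
arXiv:1207.4709 §11.3], [Li, J. reine angew. Math. 428 (1992) Thm 2.1]), local non-vanishing and the
`ε`-dichotomy [HKS JAMS 9 (1996) (1.14)–(1.15), Cor. 8.5], [Yang, Crelle 485 (1997)], with Def 3.2's fixed
splitting characters `μ₁μ₂ = μ_W`.  The prior programme machine-checks the step from these ingredients, packaged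
as `Perl34.C4.RallisDatum` + `Perl34.C4.CharsDischarge`, to this conclusion (`Perl34.C4.CharsDischarge.H_chars`);
an instance of those packages for the model would replace this fact (`Perl34.C4a.mkIsolationSetting`).
OBSTRUCTION: the local archimedean non-vanishing at the place `ι₁` for the forced signatures is PerL's Lemma
4.1/4.2 computation, not a single citable statement. -/
def Open_chars : Prop :=
  ∀ {L : CMField} {ι₁ : L →+* ℂ} (V : HermSpace3 L ι₁) (c : SeesawCtx L), T.GoodCtx ι₁ c →
    (∀ χ : (T.t12 V c).X, (T.t12 V c).allowed χ) ∧ (∀ χ : (T.t34 V c).X, (T.t34 V c).allowed χ)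

/-- **OPEN INPUT over PRINT — PerL-internal, prover-owned, never a cited fact (PerL Lemma 4.1(c) `lem:arch`, the (†) of Thm 3.7, tex ll. 479–526 and 442–443;
= hypothesis `H_occ`).** In a good context, for every isotypic component `σ̂` of `L²([U(W)])` and `Φ ∈ 𝒮^κ` with
`𝒯_Φ|_{σ̂} ≠ 0`, the archimedean type `w` (resp. `w'`) occurs in `σ_∞|_T` (resp. `|_{T'}`).  Print ingredients:
Howe duality / `K`-type structure of the Weil representation of `U(1,1) × U(2,1)` at the real place (Kashiwara–
Vergne, Invent. Math. 44 (1978); Adams, *The theta correspondence over ℝ* (2007); PerL Lemma 4.1(a),(b)), and the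
compact places.  Machine-checked from the finer package `Perl34.C4a.OccDischarge` (`Perl34.C4a.OccDischarge.H_occ`,
incl. the 2001 seat's `ν = (0,0,−2)` delivery excluding the false branch).  OBSTRUCTION: PerL's explicit `K_∞`-type
bookkeeping (Lemma 4.1(b)) is not a citable statement. -/
def Open_occ : Prop :=
  ∀ {L : CMField} {ι₁ : L →+* ℂ} (V : HermSpace3 L ι₁) (c : SeesawCtx L), T.GoodCtx ι₁ c →
    (∀ (Φ : T.SK V c) (i : T.SigIdx V c),
      (∃ v ∈ (T.core V c).hatσ i, (T.core V c).TΦ Φ v ≠ 0) → (T.t12 V c).wOccurs i) ∧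
    (∀ (Φ : T.SK V c) (i : T.SigIdx V c),
      (∃ v ∈ (T.core V c).hatσ i, (T.core V c).TΦ Φ v ≠ 0) → (T.t34 V c).wOccurs i)

/-- **The inputs of the theta model** — ONE `Prop`-valued record, one field per named input above, the fields
PARTITIONED exactly so (referee 3 R3-1.V1 option (2b); up to run 17 this record was called `ThetaModel.Inputs`):
PRINT FACTS (cited, model-fact candidates) `embCover`, `innerEmb`; DESIGN CONSTRAINTS (definitional, on the model's
own sign data; no citation claimed) `kappaConj`, `frameSignConj`; PerL OPEN INPUTS (prover-owned, never facts, =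
LEMMAS.md nodes) `thetaSub` (L3.3(a) + Prop 2.2; N12), `thetaWedge` (Prop 4.3; N33), `thetaGen12`, `thetaReal34`
(L3.5; N19w/N19g), `chars` (L4.2(b); N31), `occ` (L4.1(c); N29).  Supplying an instance for the intended model is
exactly PerL v5 §§3–4 minus Def 3.2 / Lemma 3.3 / Thm 3.7 / Thm 4.4, which are constructed or machine-checked. -/
structure Inputs : Prop where
  embCover : T.Fact_embCover
  innerEmb : T.Fact_innerEmb
  kappaConj : T.Design_kappaConj
  frameSignConj : T.Design_frameSignConj
  thetaSub : T.Open_thetaSub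
  thetaWedge : T.Open_thetaWedge
  thetaGen12 : T.Open_thetaGen12
  thetaReal34 : T.Open_thetaReal34
  chars : T.Open_chars
  occ : T.Open_occ

end ThetaModel

end Universe

end HodgeCM

end
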